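import Summits.ResolutionOfSingularities.ResolutionOfSingularities.Theorems.PurelyInseparableDim4ResConeSatUnique
import HarnessLib
import HarnessLib.Audit.Tags

/-!
# Purely inseparable four-folds — the TAME CONE AT A CONSTANT-`d` STEP, V: (SAT-LOCATED) — the new polar
# kernel cut by the exceptional hyperplane lies INSIDE THE OLD polar kernel; satellite directions are
# elements of the current vertex and, for `e_G ≤ 2`, are PREDICTED by it

[OURS · counted 0 · cell `res-dim4-pi` · desk WORD #66 (2) (K2(p) lower-band lane, owner p-12 g2) · seat
res-dim4-p-5 g2 · K lane crit-4 g2 (K-A4).]  Nothing here proves K2(p), `NoIsolatedTrap p p` or resolution of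
singularities in dimension ≥ 4 / characteristic `p`.

Setting (`…ResCone*`, p-12 g2): presented band state `s` (`x^r ∣ F`, `q < ord₀ F = o < 2q`), residual cone
`g = resForm s`, polar kernel `resVertex s` (`e_G(s) = finrank (resVertex s)`), a shade-keeping point step
`s →(j, b) s′` read in the `x_j`-chart (new exceptional hyperplane `H_j = {w_j = 0}` in the tangent space at the
new point), shade-keeping second steps `s′ →(j₁, b₁)`, SATELLITE when `j₁ ≠ j ∧ (b₁)_j = 0`.

The observation: the coordinate shear `shearVec j b` of FILE 3b-i FIXES every vector of `H_j`, so p-12 g2's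
injection `resVertex s′ ⊓ H_j ↪ A(shear_j^b g)` (`resVertex_step_inf_hyperplane_le`, p668665) composed with
`mem_additiveSubspace_shear_iff` (p667921) lands in `A(g) = resVertex s` ITSELF:

* `shearVec_eq_self_of_apply_eq_zero`, `mem_additiveSubspace_shear_iff_of_apply_eq_zero` — on `H_j` the
  sheared and the unsheared polar kernels agree;
* **`resVertex_step_inf_hyperplane_le_resVertex`** — `resVertex s′ ⊓ H_j ≤ resVertex s ⊓ H_j`: THE NEW VERTEX
  CUT BY `T(E_new)` SITS INSIDE THE OLD VERTEX (same affine coordinates);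
* **`direction_mem_resVertex_of_satellite`** (SAT-LOCATED) — the direction of a shade-keeping satellite second
  step lies in `resVertex s ⊓ H_j`, the CURRENT polar kernel — no rank hypothesis;
* **`finrank_resVertex_inf_hyperplane_add_one`** — `finrank (resVertex s ⊓ H_j) + 1 = e_G(s)` (the step's own
  direction `e_j + b ∈ resVertex s` leaves `H_j`), and the equality case of (VT)(iii):
  **`resVertex_step_inf_hyperplane_eq_of_finrank_eq`** — on a constant-`e_G` step
  `resVertex s′ ⊓ H_j = resVertex s ⊓ H_j`, with transversality **`not_resVertex_step_le_hyperplane_of_finrank_eq`**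
  (`e_G ≥ 1` constant ⇒ the new vertex leaves `H_j`);
* **`satellite_direction_eq_smul_of_mem_resVertex`** (SAT-PREDICTED, `e_G(s) ≤ 2`) — for ANY non-zero
  `u ∈ resVertex s` with `u_j = 0`, a shade-keeping satellite second step `(j₁, b₁)` has `u j₁ ≠ 0` and
  `direction j₁ b₁ = (u j₁)⁻¹ • u`: on an `e_G ≡ 2` stretch the satellite point two stages ahead is COMPUTED from
  the present plane `resVertex s` and the chart `j` (it is `ℙ(resVertex s ∩ H_j)`).

[cite: CossartJannsenSaito2020, Thm. 3.10(4), Thm. 3.14, Thm. 9.3]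
bears_on: LADDER-RESOLUTION:D157-DOOR2 (res-dim4-pi · K2(p) = `RidgeBudget.NoAboveFloorTrap p p`, lower band).
Supports stmt-ResolutionOfSingularities-16155 (helper).
-/

set_option linter.dupNamespace false -- mandated namespace of this single-conjunct summit

noncomputable section

namespace Summit.ResolutionOfSingularities.ResolutionOfSingularities.Theorems.PIDim4

namespace ResCone

open MvPolynomial Finset
open Literature.AlgebraicGeometry.Resolution
open Literature.AlgebraicGeometry.Resolution.CentreBlowup
open Literature.AlgebraicGeometry.Resolution.Hauser2010
open Literature.AlgebraicGeometry.Resolution.HauserPerlega2019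
open PointBlowup (polarMap additiveSubspace direction)

variable {K : Type} [Field K]

/-! ## 1. The coordinate shear fixes the exceptional hyperplane -/

/-- The vector shear `w ↦ (w_i + t_i w_j)_i` fixes every vector with `w_j = 0`. [folklore] -/
theorem shearVec_eq_self_of_apply_eq_zero (j : Fin 4) (t : Fin 4 → K) {w : Fin 4 → K} (hw : w j = 0) :
    shearVec j t w = w := by
  funext i
  rw [shearVec_apply]
  by_cases hij : i = j
  · rw [if_pos hij, hij]
  · rw [if_neg hij, hw, mul_zero, add_zero]

/-- On the hyperplane `{w_j = 0}` the polar kernels of a form and of its `x_j`-shear coincide. [folklore] -/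
theorem mem_additiveSubspace_shear_iff_of_apply_eq_zero (j : Fin 4) {t : Fin 4 → K} (ht : t j = 0)
    (Φ : MvPolynomial (Fin 4) K) {w : Fin 4 → K} (hw : w j = 0) :
    w ∈ additiveSubspace (shear j t Φ) ↔ w ∈ additiveSubspace Φ := by
  rw [mem_additiveSubspace_shear_iff j ht Φ w, shearVec_eq_self_of_apply_eq_zero j t hw]

/-! ## 2. The new vertex cut by `T(E_new)` lies in the old vertex -/

section Step

variable [DecidableEq K]

/-- **`resVertex s′ ⊓ H_j ≤ resVertex s ⊓ H_j`** at a shade-keeping band step `s →(j, b) s′`: the polar kernel of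
the new residual cone, cut by the tangent hyperplane of the new exceptional divisor, lies inside the polar kernel
of the old residual cone (FILE 3b-ii's `resVertex_step_inf_hyperplane_le` lands in `A(shear_j^b g)`, which agrees
with `A(g)` on `H_j`). [OURS] [cite: CossartJannsenSaito2020, Thm. 3.10(4), Thm. 9.3] -/
theorem resVertex_step_inf_hyperplane_le_resVertex {q : ℕ} (j : Fin 4) {b : Fin 4 → K} (hbj : b j = 0)
    {s : State K} {o : ℕ} (ho : ordZero s.F = o) (hr : ∀ d ∈ s.F.support, s.r ≤ d) (hqo : q < o)
    (ho2 : o < 2 * q) (heq : (CentreBlowup.step q Finset.univ j b s).shade = s.shade) :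
    resVertex (CentreBlowup.step q Finset.univ j b s) ⊓ hyperplane j ≤ resVertex s ⊓ hyperplane j := by
  intro w hw
  have hwj : w j = 0 := mem_hyperplane.mp (Submodule.mem_inf.mp hw).2
  have h := resVertex_step_inf_hyperplane_le j hbj ho hr hqo ho2 heq hw
  rw [mem_additiveSubspace_shear_iff_of_apply_eq_zero j hbj (resForm s) hwj] at h
  exact Submodule.mem_inf.mpr ⟨h, mem_hyperplane.mpr hwj⟩

/-- **(SAT-LOCATED) — the direction of a shade-keeping SATELLITE second step lies in the CURRENT polar kernel.**
For `s →(j₀, b₀) s′ →(j₁, b₁)` with both steps shade-keeping in the band and `j₁ ≠ j₀`, `(b₁)_{j₀} = 0`: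
`direction j₁ b₁ ∈ resVertex s ⊓ H_{j₀}` (no hypothesis on `e_G`). [OURS] [cite: CossartJannsenSaito2020, Thm. 3.14] -/
theorem direction_mem_resVertex_of_satellite {q : ℕ} {j₀ j₁ : Fin 4} {b₀ b₁ : Fin 4 → K} (hb₀ : b₀ j₀ = 0)
    (hb₁ : b₁ j₁ = 0) {s : State K} {o₀ o₁ : ℕ} (ho₀ : ordZero s.F = o₀)
    (hr₀ : ∀ d ∈ s.F.support, s.r ≤ d) (hqo₀ : q < o₀) (ho₀2 : o₀ < 2 * q)
    (heq₀ : (CentreBlowup.step q Finset.univ j₀ b₀ s).shade = s.shade)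
    (ho₁ : ordZero (CentreBlowup.step q Finset.univ j₀ b₀ s).F = o₁)
    (hr₁ : ∀ d ∈ (CentreBlowup.step q Finset.univ j₀ b₀ s).F.support,
      (CentreBlowup.step q Finset.univ j₀ b₀ s).r ≤ d)
    (hqo₁ : q < o₁) (ho₁2 : o₁ < 2 * q)
    (heq₁ : (CentreBlowup.step q Finset.univ j₁ b₁ (CentreBlowup.step q Finset.univ j₀ b₀ s)).shade =
      (CentreBlowup.step q Finset.univ j₀ b₀ s).shade)
    (hsat : j₁ ≠ j₀ ∧ b₁ j₀ = 0) : direction j₁ b₁ ∈ resVertex s ⊓ hyperplane j₀ :=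
  resVertex_step_inf_hyperplane_le_resVertex j₀ hb₀ ho₀ hr₀ hqo₀ ho₀2 heq₀
    (direction_mem_resVertex_inf_hyperplane_of_satellite hb₁ ho₁ hr₁ hqo₁ ho₁2 heq₁ hsat)

/-! ## 3. Ranks: the step direction leaves `H_j`; the equality case of (VT)(iii) -/

/-- **`finrank (resVertex s ⊓ H_j) + 1 = e_G(s)`** at a shade-keeping band step in the `x_j`-chart: the step's own
direction `e_j + b` lies in `resVertex s` ((VT)(i)) and has `j`-coordinate `1`. [OURS]
[cite: CossartJannsenSaito2020, Thm. 3.14] -/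
theorem finrank_resVertex_inf_hyperplane_add_one {q : ℕ} (j : Fin 4) {b : Fin 4 → K} (hbj : b j = 0)
    {s : State K} {o : ℕ} (ho : ordZero s.F = o) (hr : ∀ d ∈ s.F.support, s.r ≤ d) (hqo : q < o)
    (ho2 : o < 2 * q) (heq : (CentreBlowup.step q Finset.univ j b s).shade = s.shade) :
    Module.finrank K ↥(resVertex s ⊓ hyperplane j) + 1 = Module.finrank K (resVertex s) :=
  finrank_inf_hyperplane_add_one (resVertex s) j (direction_mem_resVertex_of_shade_eq j hbj ho hr hqo ho2 heq)
    (by rw [direction_apply_self]; exact one_ne_zero)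

/-- **Equality case of (VT)(iii)**: if the polar-kernel dimension is KEPT at a shade-keeping band step
(`e_G(s′) = e_G(s)`), then `resVertex s′ ⊓ H_j = resVertex s ⊓ H_j`. [OURS]
[cite: CossartJannsenSaito2020, Thm. 3.10(4), Thm. 9.3] -/
theorem resVertex_step_inf_hyperplane_eq_of_finrank_eq {q : ℕ} (j : Fin 4) {b : Fin 4 → K} (hbj : b j = 0)
    {s : State K} {o : ℕ} (ho : ordZero s.F = o) (hr : ∀ d ∈ s.F.support, s.r ≤ d) (hqo : q < o)
    (ho2 : o < 2 * q) (heq : (CentreBlowup.step q Finset.univ j b s).shade = s.shade)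
    (he : Module.finrank K (resVertex (CentreBlowup.step q Finset.univ j b s)) =
      Module.finrank K (resVertex s)) :
    resVertex (CentreBlowup.step q Finset.univ j b s) ⊓ hyperplane j = resVertex s ⊓ hyperplane j := by
  refine Submodule.eq_of_le_of_finrank_le
    (resVertex_step_inf_hyperplane_le_resVertex j hbj ho hr hqo ho2 heq) ?_
  have h1 := finrank_resVertex_inf_hyperplane_add_one j hbj ho hr hqo ho2 heq
  have h2 := finrank_le_finrank_inf_hyperplane_add_one
    (resVertex (CentreBlowup.step q Finset.univ j b s)) j
  omega

/-- **On a constant-`e_G` step the finer count**: `finrank (resVertex s′ ⊓ H_j) + 1 = e_G(s′)`. [OURS]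
[cite: CossartJannsenSaito2020, Thm. 3.10(4)] -/
theorem finrank_resVertex_step_inf_hyperplane_add_one_of_finrank_eq {q : ℕ} (j : Fin 4) {b : Fin 4 → K}
    (hbj : b j = 0) {s : State K} {o : ℕ} (ho : ordZero s.F = o) (hr : ∀ d ∈ s.F.support, s.r ≤ d)
    (hqo : q < o) (ho2 : o < 2 * q) (heq : (CentreBlowup.step q Finset.univ j b s).shade = s.shade)
    (he : Module.finrank K (resVertex (CentreBlowup.step q Finset.univ j b s)) =
      Module.finrank K (resVertex s)) :
    Module.finrank K ↥(resVertex (CentreBlowup.step q Finset.univ j b s) ⊓ hyperplane j) + 1 =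
      Module.finrank K (resVertex (CentreBlowup.step q Finset.univ j b s)) := by
  rw [resVertex_step_inf_hyperplane_eq_of_finrank_eq j hbj ho hr hqo ho2 heq he, he]
  exact finrank_resVertex_inf_hyperplane_add_one j hbj ho hr hqo ho2 heq

/-- **Transversality on a constant-`e_G` step**: if `e_G(s′) = e_G(s)` (so `e_G ≥ 1`, the step direction being a
non-zero element of `resVertex s`), the new polar kernel is NOT contained in the exceptional hyperplane `H_j` —
some near direction at the next stage leaves `E_new`. [OURS] [cite: CossartJannsenSaito2020, Thm. 3.10(4)] -/
theorem not_resVertex_step_le_hyperplane_of_finrank_eq {q : ℕ} (j : Fin 4) {b : Fin 4 → K} (hbj : b j = 0)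
    {s : State K} {o : ℕ} (ho : ordZero s.F = o) (hr : ∀ d ∈ s.F.support, s.r ≤ d) (hqo : q < o)
    (ho2 : o < 2 * q) (heq : (CentreBlowup.step q Finset.univ j b s).shade = s.shade)
    (he : Module.finrank K (resVertex (CentreBlowup.step q Finset.univ j b s)) =
      Module.finrank K (resVertex s)) :
    ¬ resVertex (CentreBlowup.step q Finset.univ j b s) ≤ hyperplane j := by
  intro hle
  have h := finrank_resVertex_step_inf_hyperplane_add_one_of_finrank_eq j hbj ho hr hqo ho2 heq he
  rw [inf_eq_left.mpr hle] at h
  omega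

/-! ## 4. (SAT-PREDICTED): with `e_G(s) ≤ 2` the satellite direction is read off the current vertex -/

/-- **(SAT-PREDICTED)**: if `e_G(s) ≤ 2`, `s →(j₀, b₀) s′ →(j₁, b₁)` are shade-keeping band steps and the second
is a satellite of the first, then for ANY non-zero `u ∈ resVertex s` with `u_{j₀} = 0` one has `u j₁ ≠ 0` and
`direction j₁ b₁ = (u j₁)⁻¹ • u` — the satellite point is DETERMINED by the current polar kernel and the chart
(`resVertex s ⊓ H_{j₀}` is a line, by `finrank_resVertex_inf_hyperplane_add_one`). [OURS]
[cite: CossartJannsenSaito2020, Thm. 3.14] -/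
theorem satellite_direction_eq_smul_of_mem_resVertex {q : ℕ} {j₀ j₁ : Fin 4} {b₀ b₁ : Fin 4 → K}
    (hb₀ : b₀ j₀ = 0) (hb₁ : b₁ j₁ = 0) {s : State K} {o₀ o₁ : ℕ} (ho₀ : ordZero s.F = o₀)
    (hr₀ : ∀ d ∈ s.F.support, s.r ≤ d) (hqo₀ : q < o₀) (ho₀2 : o₀ < 2 * q)
    (heq₀ : (CentreBlowup.step q Finset.univ j₀ b₀ s).shade = s.shade)
    (ho₁ : ordZero (CentreBlowup.step q Finset.univ j₀ b₀ s).F = o₁)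
    (hr₁ : ∀ d ∈ (CentreBlowup.step q Finset.univ j₀ b₀ s).F.support,
      (CentreBlowup.step q Finset.univ j₀ b₀ s).r ≤ d)
    (hqo₁ : q < o₁) (ho₁2 : o₁ < 2 * q)
    (heq₁ : (CentreBlowup.step q Finset.univ j₁ b₁ (CentreBlowup.step q Finset.univ j₀ b₀ s)).shade =
      (CentreBlowup.step q Finset.univ j₀ b₀ s).shade)
    (hsat : j₁ ≠ j₀ ∧ b₁ j₀ = 0) (he : Module.finrank K (resVertex s) ≤ 2)
    {u : Fin 4 → K} (hu : u ∈ resVertex s) (huj : u j₀ = 0) (hu0 : u ≠ 0) :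
    u j₁ ≠ 0 ∧ direction j₁ b₁ = (u j₁)⁻¹ • u := by
  have hW1 : Module.finrank K ↥(resVertex s ⊓ hyperplane j₀) ≤ 1 := by
    have h := finrank_resVertex_inf_hyperplane_add_one j₀ hb₀ ho₀ hr₀ hqo₀ ho₀2 heq₀
    omega
  have hum : u ∈ resVertex s ⊓ hyperplane j₀ := Submodule.mem_inf.mpr ⟨hu, mem_hyperplane.mpr huj⟩
  have hdm := direction_mem_resVertex_of_satellite hb₀ hb₁ ho₀ hr₀ hqo₀ ho₀2 heq₀ ho₁ hr₁ hqo₁ ho₁2 heq₁ hsat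
  have hnz : (⟨u, hum⟩ : ↥(resVertex s ⊓ hyperplane j₀)) ≠ 0 := fun h => hu0 (congrArg Subtype.val h)
  have hW : Module.finrank K ↥(resVertex s ⊓ hyperplane j₀) = 1 := by
    by_contra hne
    have h0 : resVertex s ⊓ hyperplane j₀ = ⊥ := Submodule.finrank_eq_zero.mp (by omega)
    have hum' := hum
    rw [h0, Submodule.mem_bot] at hum'
    exact hu0 hum'
  obtain ⟨c, hc⟩ := (finrank_eq_one_iff_of_nonzero' _ hnz).mp hW ⟨direction j₁ b₁, hdm⟩
  have hc' : c • u = direction j₁ b₁ := congrArg Subtype.val hc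
  have h1 : c * u j₁ = 1 := by
    have h := congr_fun hc' j₁
    rwa [Pi.smul_apply, smul_eq_mul, direction_apply_self] at h
  have hu1 : u j₁ ≠ 0 := fun h => by rw [h, mul_zero] at h1; exact zero_ne_one h1
  refine ⟨hu1, ?_⟩
  rw [← hc', ← eq_inv_of_mul_eq_one_left h1]

end Step

end ResCone

end Summit.ResolutionOfSingularities.ResolutionOfSingularities.Theorems.PIDim4

end
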